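import Summits.Ventures.YMGap.RobustBall.Defs
import Summits.Ventures.YMGap.RobustBall.TermPerturbation
import HarnessLib

/-!
# YM3IR / ReceiverWitness — the RECEIVER's half of the A3 port lemma (M4): (R1) oscillation and (R2) Cauchy–Schwarz Lipschitz witnesses, (R3) the currency-free load doors

HONEST FRAMING (cell pub-ymgap, track Y4 / YM3-IR, seat ym3ir-theory-2; label K = kernel bookkeeping; tree edition, g44,
2026-08-24, of the farm-checked HOME scratches `HOME/ym3ir/lean/ReceiverSketch-theory2.scratch.lean` v2 sha16 d33c0d712009dc35
§§1–2 and `SteinerCurrency-theory2.scratch.lean` v1.2 sha16 605f8fc0f6b92b6e §7, stated directly over track Y2's objects).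
Lead ruling R334 (A3 receiver-port ruling), D1: port file M4 `YM3IR/ReceiverWitness.lean` = the CURRENCY-FREE Cauchy half,
owner theory-2; D3 = YES option (St) (no connectivity hypothesis (E2) in the port); D4 = ∃-form.  This file contains NO
conjecture name, NO `sorry`, NO axiom beyond the standard three, defines nothing under `RobustBall/` (track Y2's
`Perturbation`, `LoadWitness`, `InBall`, `ClusterDomain` are imported READ-ONLY) and claims NO mass gap, NO continuum limit,
NO part of Bałaban's theorems and NO membership of any ultraviolet output in any ball: hypothesis (E1) below (a UNIFORM
complex analyticity radius `r` around EVERY real configuration, with sup bounds `M_X`) is exactly what a printed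
renormalisation-group output does NOT supply as stated (INTERFACE-MEMO-theory2.md M1), and the smallness of the weighted
sums `η, η₁` inside track Y2's certified radii is the crossover question (words in print).  A typed DICTIONARY only.

* §1 (R1) `oscOfSup W`: sup norms give the oscillation witness `2‖W_X‖_∞ 𝟙[e ∈ links X]`; `receiverWitness W lip hlip :
  LoadWitness W` packages it with ANY Lipschitz witness.  §2 (R2) `dist_le_of_differentiableOn_ball` (Schwarz on the complex
  line through the centre: holomorphic, bounded by `M` on `ball c R` ⇒ `dist (F z) (F c) ≤ (2M/R) dist z c`); hence (E1) makes
  `lipOfAnalytic M r X = (2M_X/r) 𝟙[y ∈ links X]` an `IsLipBound suFrobDist` witness of every activity (`isLipBound_lipOfAnalytic`;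
  `ρ` `1`-Lipschitz into `(M_N(ℂ), ‖·‖_F)` — equality for the defining representation, `dist_fundamentalRep_eq`).
* §3 (R3) LOAD DOORS, currency-free: such a witness (`osc ≤ 2M`, `lip = 2M/r` on the links of each support) and a weight `ω`
  DOMINATING the diameter weight on the support, `M S ≠ 0 → e^{κ diam S} ≤ A ω S`, with per-SITE sums `∑_{S ∋ y} M_S ω(S) ≤ η`,
  `∑_{S ∋ y} M_S |S| ω(S) ≤ η₁`, give `InBall κ (2Aη) ((2d/r) A η₁)` (`inBall_of_dominatedData`); (β) an AFFINE DIAMETER BOUND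
  `diam S ≤ s S + a`, rates `0 ≤ κ_b ≤ κ_s`, weight `e^{κ_s s S}`: rider `e^{κ_b a}` on both radii (`inBall_of_affineDiamData`);
  (δ) the ℕ-shape `diam S ≤ (t S − 1) + (c − 1)` exactly as the SENDER's re-indexing half delivers it at block scale `c`
  (`YM3IR/Reindex.lean`, seat ym3ir-theory-1 — not imported; the halves meet at HYPOTHESES) (`inBall_of_natAffineDiamData`).
* §4 END TO END at the receiver's scale: (E1) + an affine diameter bound on the support + the two weighted sums ⇒
  `W ∈ ClusterDomain κ_b (2 e^{κ_b a} η) ((2d/r) e^{κ_b a} η₁)` (`mem_clusterDomain_of_analytic_affineDiam`).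

NOT HERE: the Steiner size `steinerCard` (the CURRENCY of option (St)) and the (St) corollary for the re-indexed sender
(`YM3IR/Reindex*.lean`, theory-1's pen; check record `HOME/ym3ir/lean/D3PortJoint-monolith-theory2.check.lean` §J).
-/

noncomputable section

open Finset Function Metric
open scoped Matrix.Norms.Frobenius
open Literature.Probability.LatticeModels Literature.Probability.LatticeModels.DobrushinMetric
open Literature.MathematicalPhysics.QuantumLattice hiding torusNorm
open Literature.MathematicalPhysics.QuantumFieldTheory hiding ZdEdge

namespace Summit.Ventures.YMGap.YM3IR.ReceiverWitness

open Summit.Ventures.YMGap.RobustBall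

variable {d L N : ℕ} [NeZero L]

/-! ## §1 (R1) The oscillation witness from sup norms -/

/-- (R1) The oscillation witness read off the sup norms: `2‖W_X‖_∞` on the links of `X`, `0` off `X`. [folklore] -/
def oscOfSup (W : Perturbation d L N) (X : Finset (Site d L)) (e : Edge d L) : ℝ :=
  if e ∈ polymerEdges 1 X then 2 * W.supNorm X else 0

/-- (R1) `oscOfSup` is a legitimate `Dobrushin.IsOscBound` witness of every activity. [folklore] -/
theorem isOscBound_oscOfSup (W : Perturbation d L N) (X : Finset (Site d L)) :
    Dobrushin.IsOscBound (W.act X) (oscOfSup W X) := by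
  classical
  have h := (Dobrushin.IsOscBound.of_abs_le (W.supNorm_nonneg X) (W.abs_act_le_supNorm X)).restrict
    (W.dependsOn' X)
  refine h.mono fun e => ?_
  unfold oscOfSup; split_ifs <;> exact le_rfl

/-- `oscOfSup ≤ 2M` termwise for any majorant `M` of the sup norms. [folklore] -/
theorem oscOfSup_le (W : Perturbation d L N) {M : Finset (Site d L) → ℝ} (hM : ∀ X, W.supNorm X ≤ M X)
    (X : Finset (Site d L)) (e : Edge d L) : oscOfSup W X e ≤ 2 * M X := by
  have h0 : 0 ≤ M X := (W.supNorm_nonneg X).trans (hM X)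
  unfold oscOfSup; split_ifs <;> linarith [hM X]

/-- The receiver's load witness: (R1) oscillations, and a GIVEN Lipschitz witness `lip`. [folklore] -/
def receiverWitness (W : Perturbation d L N) (lip : Finset (Site d L) → Edge d L → ℝ)
    (hlip : ∀ X, IsLipBound suFrobDist (W.act X) (lip X)) : LoadWitness W :=
  ⟨oscOfSup W, lip, isOscBound_oscOfSup W, hlip⟩

/-- At block scale `1` the polymers through the LINK `e` are the polymers through its base SITE `e.1`. [folklore] -/
theorem polymersThroughEdge_eq (e : Edge d L) :
    polymersThroughEdge (d := d) (L := L) e = polymersThrough 1 e.1 := by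
  unfold polymersThroughEdge polymersThrough
  exact Finset.filter_congr fun X _ => by simp

/-! ## §2 (R2) The Lipschitz witness from a uniform analyticity radius (Cauchy–Schwarz) -/

/-- **Schwarz on a segment**: `F` holomorphic on `ball c R` and bounded there by `M` ⇒ `dist (F z) (F c) ≤ (2M/R) dist z c`
for `z ∈ ball c R` (Mathlib's `Complex.dist_le_div_mul_dist_of_mapsTo_ball` on the complex line through `c`, `z`). [folklore] -/
theorem dist_le_of_differentiableOn_ball {E : Type*} [NormedAddCommGroup E] [NormedSpace ℂ E]
    {F : E → ℂ} {c z : E} {R M : ℝ} (hR : 0 < R)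
    (hF : DifferentiableOn ℂ F (ball c R)) (hB : ∀ w ∈ ball c R, ‖F w‖ ≤ M) (hz : z ∈ ball c R) :
    dist (F z) (F c) ≤ 2 * M / R * dist z c := by
  by_cases hzc : z = c
  · subst hzc; simp
  have hM : 0 ≤ M := (norm_nonneg _).trans (hB c (mem_ball_self hR))
  set δ : ℝ := dist z c with hδ
  have hδ0 : 0 < δ := dist_pos.2 hzc
  have hδR : δ < R := mem_ball.1 hz
  set u : E := ((δ : ℂ)⁻¹) • (z - c) with hu
  have hnu : ‖u‖ = 1 := by
    rw [hu, norm_smul, norm_inv, Complex.norm_real, Real.norm_eq_abs, abs_of_pos hδ0, ← dist_eq_norm,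
      ← hδ, inv_mul_cancel₀ hδ0.ne']
  set ℓ : ℂ → E := fun t => c + t • u with hℓ
  have hℓball : Set.MapsTo ℓ (ball (0 : ℂ) R) (ball c R) := by
    intro t ht; rw [mem_ball, dist_eq_norm] at ht ⊢
    simpa [hℓ, norm_smul, hnu] using ht
  have hℓdiff : Differentiable ℂ ℓ := (differentiable_const c).add (differentiable_id.smul_const u)
  set f : ℂ → ℂ := F ∘ ℓ with hf
  have hfd : DifferentiableOn ℂ f (ball (0 : ℂ) R) := hF.comp hℓdiff.differentiableOn hℓball
  have hf0 : f 0 = F c := by simp [hf, hℓ]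
  have hfδ : f δ = F z := by
    simp only [hf, hℓ, hu, Function.comp_apply, smul_smul, mul_inv_cancel₀ (by exact_mod_cast hδ0.ne' : (δ : ℂ) ≠ 0),
      one_smul, add_sub_cancel]
  have hδmem : (δ : ℂ) ∈ ball (0 : ℂ) R := by
    rwa [mem_ball, dist_zero_right, Complex.norm_real, Real.norm_eq_abs, abs_of_pos hδ0]
  have hmaps : Set.MapsTo f (ball (0 : ℂ) R) (closedBall (f 0) (2 * M)) := by
    intro t ht; rw [mem_closedBall]
    have h1 : ‖f t‖ ≤ M := hB _ (hℓball ht)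
    have h2 : ‖f 0‖ ≤ M := by rw [hf0]; exact hB c (mem_ball_self hR)
    calc dist (f t) (f 0) ≤ ‖f t‖ + ‖f 0‖ := dist_le_norm_add_norm _ _
      _ ≤ 2 * M := by linarith
  have h := Complex.dist_le_div_mul_dist_of_mapsTo_ball hfd hmaps hδmem
  rw [hfδ, hf0, dist_zero_right, Complex.norm_real, Real.norm_eq_abs, abs_of_pos hδ0] at h
  simpa [hδ] using h

/-- (R2) The Lipschitz witness read off a uniform analyticity radius: `2M_X/r` on the links of `X`, `0` off `X`. [folklore] -/
def lipOfAnalytic (M : Finset (Site d L) → ℝ) (r : ℝ) (X : Finset (Site d L)) (y : Edge d L) : ℝ :=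
  if y ∈ polymerEdges 1 X then 2 * M X / r else 0

/-- `lipOfAnalytic M r X y = 2 M_X / r` on the links of `X`. [folklore] -/
theorem lipOfAnalytic_of_mem {M : Finset (Site d L) → ℝ} {r : ℝ} {X : Finset (Site d L)} {y : Edge d L}
    (hy : y ∈ polymerEdges (d := d) (L := L) 1 X) : lipOfAnalytic M r X y = 2 * M X / r := by
  simp [lipOfAnalytic, hy]

/-- Real configurations agreeing off the link `y` are, after a `1`-Lipschitz `ρ`, at distance `≤ suFrobDist (σ y) (τ y)`. [folklore] -/
theorem dist_complexify_le (ρ : SUN N →* Matrix (Fin N) (Fin N) ℂ)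
    (hρ : ∀ a b : SUN N, dist (ρ a) (ρ b) ≤ suFrobDist a b)
    {σ τ : GaugeConfig d L (SUN N)} {y : Edge d L} (h : ∀ z, z ≠ y → σ z = τ z) :
    dist (complexify ρ τ) (complexify ρ σ) ≤ suFrobDist (σ y) (τ y) := by
  refine (dist_pi_le_iff (suFrobDist_nonneg _ _)).2 fun e => ?_
  by_cases he : e = y
  · subst he
    simpa [complexify, suFrobDist_comm] using hρ (τ e) (σ e)
  · simp [complexify, h e he]; exact suFrobDist_nonneg _ _

/-- **(R2).** (E1) — a UNIFORM analyticity radius `r` around every real configuration, sup bounds `M` on the domains —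
makes `lipOfAnalytic M r X` a legitimate `IsLipBound suFrobDist` witness of EVERY activity `W_X`. [folklore] -/
theorem isLipBound_lipOfAnalytic (W : Perturbation d L N) (ρ : SUN N →* Matrix (Fin N) (Fin N) ℂ)
    (hρ : ∀ a b : SUN N, dist (ρ a) (ρ b) ≤ suFrobDist a b)
    {D : Finset (Site d L) → Set (ComplexGaugeConfig d L N)} {M : Finset (Site d L) → ℝ} {r : ℝ}
    (hr : 0 < r) (hA : W.IsAnalyticOn ρ D M) (hE1 : ∀ X (U : GaugeConfig d L (SUN N)), ball (complexify ρ U) r ⊆ D X)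
    (X : Finset (Site d L)) :
    IsLipBound suFrobDist (W.act X) (lipOfAnalytic M r X) := by
  classical
  obtain ⟨F, hFd, hFW, hFM⟩ := hA X (mem_polymers_one X)
  have hmemD : ∀ U : GaugeConfig d L (SUN N), complexify ρ U ∈ D X :=
    fun U => hE1 X U (mem_ball_self hr)
  have hM : 0 ≤ M X := (norm_nonneg _).trans (hFM _ (hmemD 1))
  have hval : ∀ U : GaugeConfig d L (SUN N), (W.act X U : ℂ) = F (complexify ρ U) :=
    fun U => (hFW U (hmemD U)).symm
  have habs : ∀ σ τ : GaugeConfig d L (SUN N),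
      |W.act X σ - W.act X τ| = dist (F (complexify ρ τ)) (F (complexify ρ σ)) := by
    intro σ τ
    rw [dist_comm, Complex.dist_eq, ← hval, ← hval, ← Complex.ofReal_sub, Complex.norm_real, Real.norm_eq_abs]
  refine ⟨fun y => ?_, fun y σ τ hστ => ?_⟩
  · unfold lipOfAnalytic; split_ifs <;> positivity
  unfold lipOfAnalytic
  split_ifs with hy
  · have hdist := dist_complexify_le (d := d) (L := L) ρ hρ hστ
    set c := complexify ρ σ
    set z := complexify ρ τ
    rw [habs]
    by_cases hzr : dist z c < r
    · have h := dist_le_of_differentiableOn_ball hr (hFd.mono (hE1 X σ))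
        (fun w hw => hFM w (hE1 X σ hw)) (mem_ball.2 hzr)
      calc dist (F z) (F c) ≤ 2 * M X / r * dist z c := h
        _ ≤ 2 * M X / r * suFrobDist (σ y) (τ y) := by gcongr
    · rw [not_lt] at hzr
      have h1 : ‖F z‖ ≤ M X := hFM z (hmemD τ)
      have h2 : ‖F c‖ ≤ M X := hFM c (hmemD σ)
      have hrd : r ≤ suFrobDist (σ y) (τ y) := hzr.trans hdist
      calc dist (F z) (F c) ≤ ‖F z‖ + ‖F c‖ := dist_le_norm_add_norm _ _
        _ ≤ 2 * M X := by linarith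
        _ = 2 * M X / r * r := by field_simp
        _ ≤ 2 * M X / r * suFrobDist (σ y) (τ y) := by gcongr
  · have hdep := W.dependsOn' X
    have : W.act X σ = W.act X τ :=
      hdep fun e he => hστ e fun h' => hy (h' ▸ (Finset.mem_coe.1 he))
    simp [this]

/-- Real values through the analytic extension: `‖W_X‖_∞ ≤ M_X` when the domains contain the real configurations. [folklore] -/
theorem supNorm_le_of_isAnalyticOn (W : Perturbation d L N) (ρ : SUN N →* Matrix (Fin N) (Fin N) ℂ)
    {D : Finset (Site d L) → Set (ComplexGaugeConfig d L N)} {M : Finset (Site d L) → ℝ}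
    (hA : W.IsAnalyticOn ρ D M) (hD : ∀ X (U : GaugeConfig d L (SUN N)), complexify ρ U ∈ D X)
    (X : Finset (Site d L)) : W.supNorm X ≤ M X := by
  obtain ⟨F, -, hFW, hFM⟩ := hA X (mem_polymers_one X)
  refine W.supNorm_le fun U => ?_
  have h := hFM _ (hD X U)
  rwa [hFW U (hD X U), Complex.norm_real, Real.norm_eq_abs] at h

/-- For the DEFINING representation the `1`-Lipschitz hypothesis holds with equality. [folklore] -/
theorem dist_fundamentalRep_eq (a b : SUN N) :
    dist (fundamentalRep (Fin N) a) (fundamentalRep (Fin N) b) = suFrobDist a b := by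
  rw [dist_eq_norm, suFrobDist, frobNorm_eq_norm, fundamentalRep_apply, fundamentalRep_apply]

/-! ## §3 (R3) The load doors into track Y2's ball — currency-free -/

/-- **Cross load, fibrewise**: `Λ_κ(e) = ∑_{X ∋ e} e^{κ diam X} ∑_{y ∈ links X, y ≠ e} lip X y` (exchange of sums). [folklore] -/
theorem crossLipLoad_eq_sum {W : Perturbation d L N} (w : LoadWitness W) (κ : ℝ) (e : Edge d L) :
    w.crossLipLoad κ e = ∑ X ∈ polymersThroughEdge e,
      Real.exp (κ * polymerDiam X) * ∑ y ∈ (polymerEdges 1 X).erase e, w.lip X y := by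
  classical
  unfold LoadWitness.crossLipLoad LoadWitness.crossLip
  calc ∑ y ∈ univ.erase e, ∑ X ∈ (polymersThroughEdge e).filter (fun X => y ∈ polymerEdges 1 X),
          Real.exp (κ * polymerDiam X) * w.lip X y
      = ∑ y ∈ univ.erase e, ∑ X ∈ polymersThroughEdge e,
          (if y ∈ polymerEdges 1 X then Real.exp (κ * polymerDiam X) * w.lip X y else 0) := by
        refine sum_congr rfl fun y _ => ?_
        rw [sum_filter]
    _ = ∑ X ∈ polymersThroughEdge e, ∑ y ∈ univ.erase e,
          (if y ∈ polymerEdges 1 X then Real.exp (κ * polymerDiam X) * w.lip X y else 0) := sum_comm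
    _ = ∑ X ∈ polymersThroughEdge e,
          Real.exp (κ * polymerDiam X) * ∑ y ∈ (polymerEdges 1 X).erase e, w.lip X y := by
        refine sum_congr rfl fun X _ => ?_
        rw [← sum_filter, mul_sum]
        refine sum_congr ?_ fun _ _ => rfl
        ext y
        simp [mem_erase, and_comm]

/-- **Self + cross load of a witness constant on the links of each polymer**: `lip X y = c X` on `links X` ⇒
`ℓ_s(e) + Λ(e) = ∑_{X ∋ e} e^{κ diam X} c_X · (d|X|)` (a polymer has `d|X|` links at block scale `1`). [folklore] -/
theorem selfAddCross_eq {W : Perturbation d L N} (w : LoadWitness W) (c : Finset (Site d L) → ℝ)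
    (hc : ∀ X, ∀ y ∈ polymerEdges (d := d) (L := L) 1 X, w.lip X y = c X) (κ : ℝ) (e : Edge d L) :
    w.selfLipLoad κ e + w.crossLipLoad κ e
      = ∑ X ∈ polymersThroughEdge e, Real.exp (κ * polymerDiam X) * c X * (X.card * d) := by
  classical
  rw [crossLipLoad_eq_sum, LoadWitness.selfLipLoad, ← sum_add_distrib]
  refine sum_congr rfl fun X hX => ?_
  have heX : e ∈ polymerEdges 1 X := (Finset.mem_filter.1 hX).2
  have hin : ∑ y ∈ (polymerEdges 1 X).erase e, w.lip X y = ((polymerEdges 1 X).erase e).card * c X := by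
    rw [Finset.sum_congr rfl fun y hy => hc X y (Finset.mem_of_mem_erase hy), sum_const, nsmul_eq_mul]
  rw [hin, hc X e heX]
  have hlinks : (polymerEdges (d := d) (L := L) 1 X).card = X.card * d := by
    have h : polymerEdges (d := d) (L := L) 1 X = X ×ˢ (Finset.univ : Finset (Fin d)) := by
      ext e'; simp [Finset.mem_product]
    rw [h, Finset.card_product, Finset.card_univ, Fintype.card_fin]
  have hcard : (((polymerEdges 1 X).erase e).card : ℝ) + 1 = X.card * d := by
    have h := Finset.card_erase_add_one heX
    rw [hlinks] at h; exact_mod_cast h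
  calc Real.exp (κ * polymerDiam X) * c X
        + Real.exp (κ * polymerDiam X) * (((polymerEdges 1 X).erase e).card * c X)
      = Real.exp (κ * polymerDiam X) * c X * ((((polymerEdges 1 X).erase e).card : ℝ) + 1) := by ring
    _ = Real.exp (κ * polymerDiam X) * c X * (X.card * d) := by rw [hcard]

omit [NeZero L] in
/-- The termwise key of the doors: under the DOMINATION hypothesis (stated only where `M ≠ 0`),
`M_X e^{κ diam X} ≤ A · M_X ω(X)` for `M_X ≥ 0`. [folklore] -/
theorem mul_expDiam_le_of_dominated {M ω : Finset (Site d L) → ℝ} {κ A : ℝ}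
    (hdom : ∀ X, M X ≠ 0 → Real.exp (κ * polymerDiam X) ≤ A * ω X)
    {X : Finset (Site d L)} (hM : 0 ≤ M X) :
    M X * Real.exp (κ * polymerDiam X) ≤ A * (M X * ω X) := by
  by_cases h0 : M X = 0
  · simp [h0]
  · exact (mul_le_mul_of_nonneg_left (hdom X h0) hM).trans_eq (by ring)

/-- (R3) ε₀-coordinate: track Y2's weighted oscillation load `≤ 2Aη` at every link, from `osc ≤ 2M`, the domination
`hdom` and the per-site `ω`-weighted bound `∑_{X ∋ y} M_X ω(X) ≤ η`. [folklore] -/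
theorem oscLoad_le_of_dominated {W : Perturbation d L N} (w : LoadWitness W) {M ω : Finset (Site d L) → ℝ}
    (hosc : ∀ X e, w.osc X e ≤ 2 * M X) {κ A η : ℝ} (hA : 0 ≤ A)
    (hdom : ∀ X, M X ≠ 0 → Real.exp (κ * polymerDiam X) ≤ A * ω X)
    (hη : ∀ y : Site d L, ∑ X ∈ polymersThrough (d := d) (L := L) 1 y, M X * ω X ≤ η)
    (e : Edge d L) : w.oscLoad κ e ≤ 2 * (A * η) := by
  classical
  have hM : ∀ X, 0 ≤ M X := fun X => by linarith [(w.osc_spec X).nonneg e, hosc X e]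
  calc w.oscLoad κ e
      = ∑ X ∈ polymersThrough (d := d) (L := L) 1 e.1, Real.exp (κ * polymerDiam X) * w.osc X e := by
        simp only [LoadWitness.oscLoad, polymersThroughEdge_eq]
    _ ≤ ∑ X ∈ polymersThrough (d := d) (L := L) 1 e.1, Real.exp (κ * polymerDiam X) * (2 * M X) :=
        sum_le_sum fun X _ => mul_le_mul_of_nonneg_left (hosc X e) (Real.exp_pos _).le
    _ = 2 * ∑ X ∈ polymersThrough (d := d) (L := L) 1 e.1, M X * Real.exp (κ * polymerDiam X) := by
        rw [mul_sum]; exact sum_congr rfl fun X _ => by ring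
    _ ≤ 2 * ∑ X ∈ polymersThrough (d := d) (L := L) 1 e.1, A * (M X * ω X) :=
        mul_le_mul_of_nonneg_left (sum_le_sum fun X _ => mul_expDiam_le_of_dominated hdom (hM X)) (by norm_num)
    _ = 2 * (A * ∑ X ∈ polymersThrough (d := d) (L := L) 1 e.1, M X * ω X) := by congr 1; rw [mul_sum]
    _ ≤ 2 * (A * η) := mul_le_mul_of_nonneg_left (mul_le_mul_of_nonneg_left (hη e.1) hA) (by norm_num)

/-- (R3) ε₁-coordinate: track Y2's weighted self + cross Lipschitz load `≤ (2d/r) A η₁` at every link, from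
`lip = 2M/r` on the links, `M ≥ 0`, the domination `hdom` and the per-site `ω`-weighted first-moment bound. [folklore] -/
theorem selfAddCross_le_of_dominated {W : Perturbation d L N} (w : LoadWitness W) {M ω : Finset (Site d L) → ℝ}
    {r : ℝ} (hr : 0 < r) (hM : ∀ X, 0 ≤ M X)
    (hlip : ∀ X, ∀ y ∈ polymerEdges (d := d) (L := L) 1 X, w.lip X y = 2 * M X / r)
    {κ A η₁ : ℝ} (hA : 0 ≤ A)
    (hdom : ∀ X, M X ≠ 0 → Real.exp (κ * polymerDiam X) ≤ A * ω X)
    (hη₁ : ∀ y : Site d L, ∑ X ∈ polymersThrough (d := d) (L := L) 1 y, M X * X.card * ω X ≤ η₁)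
    (e : Edge d L) :
    w.selfLipLoad κ e + w.crossLipLoad κ e ≤ 2 * d / r * (A * η₁) := by
  classical
  have hc : (0 : ℝ) ≤ 2 * d / r := by positivity
  rw [selfAddCross_eq w (fun X => 2 * M X / r) hlip κ e, polymersThroughEdge_eq]
  calc ∑ X ∈ polymersThrough (d := d) (L := L) 1 e.1, Real.exp (κ * polymerDiam X) * (2 * M X / r) * (X.card * d)
      = 2 * d / r * ∑ X ∈ polymersThrough (d := d) (L := L) 1 e.1, M X * Real.exp (κ * polymerDiam X) * X.card := by
        rw [mul_sum]; exact sum_congr rfl fun X _ => by ring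
    _ ≤ 2 * d / r * ∑ X ∈ polymersThrough (d := d) (L := L) 1 e.1, A * (M X * ω X) * X.card :=
        mul_le_mul_of_nonneg_left (sum_le_sum fun X _ =>
          mul_le_mul_of_nonneg_right (mul_expDiam_le_of_dominated hdom (hM X)) (Nat.cast_nonneg _)) hc
    _ = 2 * d / r * (A * ∑ X ∈ polymersThrough (d := d) (L := L) 1 e.1, M X * X.card * ω X) := by
        congr 1; rw [mul_sum]; exact sum_congr rfl fun X _ => by ring
    _ ≤ 2 * d / r * (A * η₁) := mul_le_mul_of_nonneg_left (mul_le_mul_of_nonneg_left (hη₁ e.1) hA) hc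

/-- ★★ **THE DOMINATION DOOR.** A load witness with `osc ≤ 2M`, `lip = 2M/r` on the links of each support, a weight `ω`
DOMINATING the diameter weight ON THE SUPPORT (`hdom : M S ≠ 0 → e^{κ diam S} ≤ A ω S`, `A ≥ 0`) and the per-site bounds
`∑_{S ∋ y} M_S ω(S) ≤ η`, `∑_{S ∋ y} M_S |S| ω(S) ≤ η₁` give `InBall κ (2Aη) ((2d/r) A η₁) W`.  No connectivity hypothesis,
no currency, no sign condition on `κ`; `hdom` is where the SENDER's geometry plugs in. [folklore] -/
theorem inBall_of_dominatedData {W : Perturbation d L N} (w : LoadWitness W) {M ω : Finset (Site d L) → ℝ} {r : ℝ}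
    (hr : 0 < r) (hosc : ∀ X e, w.osc X e ≤ 2 * M X)
    (hlip : ∀ X, ∀ y ∈ polymerEdges (d := d) (L := L) 1 X, w.lip X y = 2 * M X / r)
    {κ A η η₁ : ℝ} (hA : 0 ≤ A)
    (hdom : ∀ X, M X ≠ 0 → Real.exp (κ * polymerDiam X) ≤ A * ω X)
    (hη : ∀ y : Site d L, ∑ X ∈ polymersThrough (d := d) (L := L) 1 y, M X * ω X ≤ η)
    (hη₁ : ∀ y : Site d L, ∑ X ∈ polymersThrough (d := d) (L := L) 1 y, M X * X.card * ω X ≤ η₁) :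
    InBall κ (2 * (A * η)) (2 * d / r * (A * η₁)) W :=
  ⟨w, fun e => oscLoad_le_of_dominated w hosc hA hdom hη e, fun e =>
    selfAddCross_le_of_dominated w hr (fun X => by linarith [(w.osc_spec X).nonneg e, hosc X e])
      hlip hA hdom hη₁ e⟩

omit [NeZero L] in
/-- From an AFFINE DIAMETER BOUND on the support to domination: `diam S ≤ s S + a` whenever `M S ≠ 0`, `s ≥ 0`,
rates `0 ≤ κ_b ≤ κ_s` ⇒ `e^{κ_b diam S} ≤ e^{κ_b a} · e^{κ_s s S}` on the support — the RIDER `e^{κ_b a}`. [folklore] -/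
theorem expDiam_le_of_affineDiamBound {M s : Finset (Site d L) → ℝ} {κb κs a : ℝ}
    (hκb : 0 ≤ κb) (hκs : κb ≤ κs) (hs : ∀ X, 0 ≤ s X)
    (hdiam : ∀ X, M X ≠ 0 → (polymerDiam X : ℝ) ≤ s X + a) :
    ∀ X, M X ≠ 0 → Real.exp (κb * polymerDiam X) ≤ Real.exp (κb * a) * Real.exp (κs * s X) := by
  intro X hX; rw [← Real.exp_add]; refine Real.exp_le_exp.2 ?_
  have h1 : κb * (polymerDiam X : ℝ) ≤ κb * s X + κb * a := by
    have h := mul_le_mul_of_nonneg_left (hdiam X hX) hκb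
    rwa [mul_add] at h
  have h2 : κb * s X ≤ κs * s X := mul_le_mul_of_nonneg_right hκs (hs X)
  linarith

/-- ★★ (β) **THE DOOR FED BY AN AFFINE DIAMETER BOUND** (the meeting point with the sender's half): the load witness of
§1–§2, the sender's geometry as ONE line `hdiam : M S ≠ 0 → diam S ≤ s S + a`, rates `0 ≤ κ_b ≤ κ_s` and the bounds
`∑_{S ∋ y} M_S e^{κ_s s S} ≤ η`, `∑_{S ∋ y} M_S |S| e^{κ_s s S} ≤ η₁` ⇒ `InBall κ_b (2 e^{κ_b a} η) ((2d/r) e^{κ_b a} η₁) W`. [folklore] -/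
theorem inBall_of_affineDiamData {W : Perturbation d L N} (w : LoadWitness W) {M s : Finset (Site d L) → ℝ} {r : ℝ}
    (hr : 0 < r) (hosc : ∀ X e, w.osc X e ≤ 2 * M X)
    (hlip : ∀ X, ∀ y ∈ polymerEdges (d := d) (L := L) 1 X, w.lip X y = 2 * M X / r)
    {κb κs a η η₁ : ℝ} (hκb : 0 ≤ κb) (hκs : κb ≤ κs) (hs : ∀ X, 0 ≤ s X)
    (hdiam : ∀ X, M X ≠ 0 → (polymerDiam X : ℝ) ≤ s X + a)
    (hη : ∀ y : Site d L, ∑ X ∈ polymersThrough (d := d) (L := L) 1 y,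
      M X * Real.exp (κs * s X) ≤ η)
    (hη₁ : ∀ y : Site d L, ∑ X ∈ polymersThrough (d := d) (L := L) 1 y,
      M X * X.card * Real.exp (κs * s X) ≤ η₁) :
    InBall κb (2 * (Real.exp (κb * a) * η)) (2 * d / r * (Real.exp (κb * a) * η₁)) W :=
  inBall_of_dominatedData w hr hosc hlip (Real.exp_pos _).le (ω := fun X => Real.exp (κs * s X))
    (expDiam_le_of_affineDiamBound hκb hκs hs hdiam) hη hη₁

/-- ★★ (δ) **THE SEAM, LITERAL SHAPE**: the ℕ-valued bound `M S ≠ 0 → polymerDiam S ≤ (t S − 1) + (c − 1)` exactly as the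
sender's re-indexing half delivers it at block scale `c`, weight `e^{κ_s (t S − 1)}`, rates `0 ≤ κ_b ≤ κ_s` ⇒ track Y2's ball at
rate `κ_b`, rider `e^{κ_b (c − 1)}` on both radii; no cast is left to either half. [folklore] -/
theorem inBall_of_natAffineDiamData {W : Perturbation d L N} (w : LoadWitness W) {M : Finset (Site d L) → ℝ}
    {t : Finset (Site d L) → ℕ} {c : ℕ} {r : ℝ} (hr : 0 < r)
    (hosc : ∀ X e, w.osc X e ≤ 2 * M X)
    (hlip : ∀ X, ∀ y ∈ polymerEdges (d := d) (L := L) 1 X, w.lip X y = 2 * M X / r)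
    {κb κs η η₁ : ℝ} (hκb : 0 ≤ κb) (hκs : κb ≤ κs)
    (hdiam : ∀ X, M X ≠ 0 → polymerDiam X ≤ (t X - 1) + (c - 1))
    (hη : ∀ y : Site d L, ∑ X ∈ polymersThrough (d := d) (L := L) 1 y,
      M X * Real.exp (κs * ((t X - 1 : ℕ) : ℝ)) ≤ η)
    (hη₁ : ∀ y : Site d L, ∑ X ∈ polymersThrough (d := d) (L := L) 1 y,
      M X * X.card * Real.exp (κs * ((t X - 1 : ℕ) : ℝ)) ≤ η₁) :
    InBall κb (2 * (Real.exp (κb * ((c - 1 : ℕ) : ℝ)) * η))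
      (2 * d / r * (Real.exp (κb * ((c - 1 : ℕ) : ℝ)) * η₁)) W :=
  inBall_of_affineDiamData w hr hosc hlip hκb hκs (s := fun X => ((t X - 1 : ℕ) : ℝ))
    (a := ((c - 1 : ℕ) : ℝ)) (fun X => Nat.cast_nonneg _) (fun X hX => by exact_mod_cast hdiam X hX) hη hη₁

/-! ## §4 End to end at the receiver's scale: (E1) + an affine diameter bound ⇒ track Y2's tier-2 ball -/

/-- ★ **THE RECEIVER, END TO END.** (E1) — activities analytic with sup bound `M_X` on domains containing the radius-`r`
ball around EVERY real configuration, `ρ` `1`-Lipschitz into `(M_N(ℂ), ‖·‖_F)` —, an affine diameter bound `diam X ≤ s X + a`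
wherever `M_X ≠ 0`, and `∑_{X ∋ y} M_X e^{κ_s s X} ≤ η`, `∑_{X ∋ y} M_X |X| e^{κ_s s X} ≤ η₁` at every site (`0 ≤ κ_b ≤ κ_s`)
⇒ `W ∈ ClusterDomain κ_b (2 e^{κ_b a} η) ((2d/r) e^{κ_b a} η₁)`, track Y2's tier-2 ball by name. [folklore] -/
theorem mem_clusterDomain_of_analytic_affineDiam (W : Perturbation d L N) (ρ : SUN N →* Matrix (Fin N) (Fin N) ℂ)
    (hρ : ∀ a b : SUN N, dist (ρ a) (ρ b) ≤ suFrobDist a b)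
    {D : Finset (Site d L) → Set (ComplexGaugeConfig d L N)} {M : Finset (Site d L) → ℝ} {r : ℝ}
    (hr : 0 < r) (hA : W.IsAnalyticOn ρ D M)
    (hE1 : ∀ X (U : GaugeConfig d L (SUN N)), ball (complexify ρ U) r ⊆ D X)
    {s : Finset (Site d L) → ℝ} {κb κs a η η₁ : ℝ} (hκb : 0 ≤ κb) (hκs : κb ≤ κs) (hs : ∀ X, 0 ≤ s X)
    (hdiam : ∀ X, M X ≠ 0 → (polymerDiam X : ℝ) ≤ s X + a)
    (hη : ∀ y : Site d L, ∑ X ∈ polymersThrough (d := d) (L := L) 1 y, M X * Real.exp (κs * s X) ≤ η)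
    (hη₁ : ∀ y : Site d L, ∑ X ∈ polymersThrough (d := d) (L := L) 1 y,
      M X * X.card * Real.exp (κs * s X) ≤ η₁) :
    W ∈ ClusterDomain (d := d) (L := L) (N := N) κb (2 * (Real.exp (κb * a) * η))
      (2 * d / r * (Real.exp (κb * a) * η₁)) := by
  have hD : ∀ X (U : GaugeConfig d L (SUN N)), complexify ρ U ∈ D X := fun X U => hE1 X U (mem_ball_self hr)
  have hlipW := isLipBound_lipOfAnalytic W ρ hρ hr hA hE1
  exact inBall_of_affineDiamData (receiverWitness W (lipOfAnalytic M r) hlipW) hr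
    (fun X e => oscOfSup_le W (supNorm_le_of_isAnalyticOn W ρ hA hD) X e)
    (fun X y hy => lipOfAnalytic_of_mem hy) hκb hκs hs hdiam hη hη₁

end Summit.Ventures.YMGap.YM3IR.ReceiverWitness
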